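import Summits.CriticalPhenomena.SAWScalingLimit.Theorems.SAWDevelopingMapHexTransferYbRelayDefs
import Literature.Probability.RandomPlanarGeometry.HexSAWLattice
import Mathlib.Analysis.Convex.Combination
import Mathlib.Topology.Algebra.Module.FiniteDimension
import Mathlib.LinearAlgebra.Complex.FiniteDimensional

/-!
# The `π/3` dictionary, geometric part I: square coordinates for `H(π/3)` and the face domain

Helper file of the line `yb-relay` for the crux `HexTransfer` (stmt-CriticalPhenomena-14221), stub
`stub_gmHexDictionary`. At `Θ ≡ π/3` Glazman–Manolescu's rhombic tiling is an affine image of the unit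
square grid: with `s = e^{-iπ/6}` the column shift and `ζ = e^{iπ/3}`, the real-linear map
`ψ_δ (α, β) = δ (α − β ζ)` (`psi δ`) satisfies

* `(S_δ)⁻¹ (δ · rhombus (k, j)) = ψ_δ ([j, j+1] × [k, k+1])` (`symm_image_rhombus`), where
  `S_δ z = i z − i δ/2` is `gmSimilarity δ`; hence **`faceDomain Ω δ a = ψ_δ (interior ⋃ squares of
  the face component)`** (`faceDomain_eq`);
* `δ · hexCenter v = ψ_δ (sqPt v)` with `sqPt v` a point of the OPEN unit square of the rhombus
  `gmFace v` carrying the triangle `v` (`mul_hexCenter_eq_psi`, `sqPt_mem_openSq`): the honeycomb of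
  `HexSAW.lean` is carried onto the triangle centres of `H(π/3)`.

Whence the vertex half of "the canonical hexagonal discretisation of the face domain is the
honeycomb of the face component": `mul_hexCenter_mem_faceDomain_iff`. Elementary plane geometry;
tagged [folklore].
-/

noncomputable section

namespace Summit.CriticalPhenomena.SAWScalingLimit.Cruxes.HexTransfer.YbRelay

open Set
open Complex (I)
open Literature.Probability.LatticeModels
open Literature.Probability.RandomPlanarGeometry
open Literature.Probability.RandomPlanarGeometry.SAW
open Literature.Probability.RandomPlanarGeometry.SAW.YangBaxter

/-! ### Square coordinates -/

/-- The real-linear map `ψ_δ (α, β) = δ (α − β ζ)`, `ζ = e^{iπ/3}`, from square coordinates to the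
plane of `hexCenter` at mesh `δ`. [folklore] -/
def psi (δ : ℝ) : ℝ × ℝ →ₗ[ℝ] ℂ where
  toFun p := (δ : ℂ) * ((p.1 : ℂ) - (p.2 : ℂ) * triZeta)
  map_add' p q := by
    simp only [Prod.fst_add, Prod.snd_add, Complex.ofReal_add]
    ring
  map_smul' c p := by
    simp only [Prod.smul_fst, Prod.smul_snd, smul_eq_mul, Complex.ofReal_mul, RingHom.id_apply,
      Complex.real_smul]
    ring

/-- Pointwise formula for `ψ_δ`. [folklore] -/
theorem psi_apply (δ : ℝ) (p : ℝ × ℝ) : psi δ p = (δ : ℂ) * ((p.1 : ℂ) - (p.2 : ℂ) * triZeta) := rfl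

/-- `ψ_δ = δ ψ_1`. [folklore] -/
theorem psi_eq_mul_psi_one (δ : ℝ) (p : ℝ × ℝ) : psi δ p = (δ : ℂ) * psi 1 p := by
  simp [psi_apply]

/-- `ψ_δ` is injective for `δ ≠ 0` (`ζ ∉ ℝ`). [folklore] -/
theorem psi_injective {δ : ℝ} (hδ : δ ≠ 0) : Function.Injective (psi δ) := by
  intro p q h
  rw [psi_apply, psi_apply, mul_right_inj' (Complex.ofReal_ne_zero.2 hδ), Complex.ext_iff] at h
  simp only [Complex.sub_re, Complex.ofReal_re, Complex.mul_re, triZeta_re, Complex.ofReal_im, triZeta_im,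
    Complex.sub_im, Complex.mul_im] at h
  have h3 : Real.sqrt 3 ≠ 0 := by positivity
  obtain ⟨h1, h2⟩ := h
  have hb : p.2 = q.2 := by
    have : p.2 * (Real.sqrt 3 / 2) = q.2 * (Real.sqrt 3 / 2) := by linarith
    field_simp at this
    linarith
  refine Prod.ext ?_ hb
  rw [hb] at h1
  linarith

/-- `ψ_δ` as a homeomorphism `ℝ² ≃ₜ ℂ` (`δ ≠ 0`). [folklore] -/
def psiHomeo (δ : ℝ) (hδ : δ ≠ 0) : ℝ × ℝ ≃ₜ ℂ :=
  ((psi δ).linearEquivOfInjective (psi_injective hδ)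
    (by simp [Complex.finrank_real_complex])).toContinuousLinearEquiv.toHomeomorph

/-- The homeomorphism is `ψ_δ`. [folklore] -/
@[simp] theorem psiHomeo_apply (δ : ℝ) (hδ : δ ≠ 0) (p : ℝ × ℝ) : psiHomeo δ hδ p = psi δ p := by
  simp [psiHomeo]

/-- The image of a set under the homeomorphism is its image under `ψ_δ`. [folklore] -/
theorem image_psiHomeo (δ : ℝ) (hδ : δ ≠ 0) (s : Set (ℝ × ℝ)) : psiHomeo δ hδ '' s = psi δ '' s :=
  image_congr fun p _ => psiHomeo_apply δ hδ p

/-- The closed unit square of the rhombus `g = (k, j)` in square coordinates: `[j, j+1] × [k, k+1]`.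
[folklore] -/
def sq (g : Face) : Set (ℝ × ℝ) := Icc (g.2 : ℝ) (g.2 + 1) ×ˢ Icc (g.1 : ℝ) (g.1 + 1)

/-- The open unit square of the rhombus `g`. [folklore] -/
def openSq (g : Face) : Set (ℝ × ℝ) := Ioo (g.2 : ℝ) (g.2 + 1) ×ˢ Ioo (g.1 : ℝ) (g.1 + 1)

/-- The open square is open. [folklore] -/
theorem isOpen_openSq (g : Face) : IsOpen (openSq g) := isOpen_Ioo.prod isOpen_Ioo

/-- The closed square is convex. [folklore] -/
theorem convex_sq (g : Face) : Convex ℝ (sq g) := (convex_Icc _ _).prod (convex_Icc _ _)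

/-- The open square lies in the closed one. [folklore] -/
theorem openSq_subset_sq (g : Face) : openSq g ⊆ sq g := prod_mono Ioo_subset_Icc_self Ioo_subset_Icc_self

/-- The closed square is the closure of the open one. [folklore] -/
theorem closure_openSq (g : Face) : closure (openSq g) = sq g := by
  rw [openSq, closure_prod_eq, closure_Ioo (by linarith), closure_Ioo (by linarith)]
  rfl

/-- **Grid lemma**: a point of the open square of `f` lies in the closed square of `g` only if
`f = g`. [folklore] -/
theorem eq_of_mem_openSq_of_mem_sq {f g : Face} {p : ℝ × ℝ} (h1 : p ∈ openSq f) (h2 : p ∈ sq g) : f = g := by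
  obtain ⟨⟨a1, a2⟩, ⟨b1, b2⟩⟩ := h1
  obtain ⟨⟨c1, c2⟩, ⟨d1, d2⟩⟩ := h2
  have e2 : f.2 = g.2 := by
    have i1 : (g.2 : ℝ) < f.2 + 1 := by linarith
    have i2 : (f.2 : ℝ) < g.2 + 1 := by linarith
    have := (show (g.2 : ℝ) < (f.2 + 1 : ℤ) by push_cast; exact i1)
    have := (show (f.2 : ℝ) < (g.2 + 1 : ℤ) by push_cast; exact i2)
    have j1 : g.2 < f.2 + 1 := by exact_mod_cast ‹(g.2 : ℝ) < ((f.2 + 1 : ℤ) : ℝ)›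
    have j2 : f.2 < g.2 + 1 := by exact_mod_cast ‹(f.2 : ℝ) < ((g.2 + 1 : ℤ) : ℝ)›
    omega
  have e1 : f.1 = g.1 := by
    have i1 : (g.1 : ℝ) < f.1 + 1 := by linarith
    have i2 : (f.1 : ℝ) < g.1 + 1 := by linarith
    have j1 : g.1 < f.1 + 1 := by exact_mod_cast (show (g.1 : ℝ) < ((f.1 + 1 : ℤ) : ℝ) by push_cast; exact i1)
    have j2 : f.1 < g.1 + 1 := by exact_mod_cast (show (f.1 : ℝ) < ((g.1 + 1 : ℤ) : ℝ) by push_cast; exact i2)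
    omega
  exact Prod.ext e1 e2

/-- The open square of a face of `C` lies in the interior of the union of the closed squares of `C`.
[folklore] -/
theorem openSq_subset_interior {C : Set Face} {g : Face} (hg : g ∈ C) : openSq g ⊆ interior (⋃ g ∈ C, sq g) :=
  interior_maximal ((openSq_subset_sq g).trans (subset_iUnion₂ (s := fun g _ => sq g) g hg)) (isOpen_openSq g)

/-- The closed square of a face of `C` lies in the closure of the interior of the union. [folklore] -/
theorem sq_subset_closure_interior {C : Set Face} {g : Face} (hg : g ∈ C) :
    sq g ⊆ closure (interior (⋃ g ∈ C, sq g)) := by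
  rw [← closure_openSq]
  exact closure_mono (openSq_subset_interior hg)

/-- A point of the open square of `f` in the closure of the union of the squares of `C` forces
`f ∈ C`. [folklore] -/
theorem mem_of_mem_openSq_of_mem_closure {C : Set Face} {f : Face} {p : ℝ × ℝ} (h1 : p ∈ openSq f)
    (h2 : p ∈ closure (⋃ g ∈ C, sq g)) : f ∈ C := by
  rw [mem_closure_iff] at h2
  obtain ⟨q, hq1, hq2⟩ := h2 (openSq f) (isOpen_openSq f) h1
  simp only [mem_iUnion, exists_prop] at hq2
  obtain ⟨g, hg, hqg⟩ := hq2
  rwa [eq_of_mem_openSq_of_mem_sq hq1 hqg]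

/-! ### The tiling `H(π/3)` in square coordinates -/

/-- At `Θ ≡ π/3` every column has the same shift `s = sin(π/3) − cos(π/3) i = e^{-iπ/6}`. [folklore] -/
theorem colShift_third (k : ℤ) : colShift third k = colShift third 0 := rfl

/-- `i · s = ζ`: `i e^{-iπ/6} = e^{iπ/3}`. [folklore] -/
theorem I_mul_colShift_third : I * colShift third 0 = triZeta := by
  rw [colShift, triZeta_eq]
  change I * ((Real.sin (Real.pi / 3) : ℂ) - (Real.cos (Real.pi / 3) : ℂ) * I) = _
  rw [Real.sin_pi_div_three, Real.cos_pi_div_three]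
  apply Complex.ext <;> simp

/-- At `Θ ≡ π/3` the column offset is `k s` for every `k ∈ ℤ`. [folklore] -/
theorem colOffset_third (k : ℤ) : colOffset third k = (k : ℂ) * colShift third 0 := by
  induction k using Int.induction_on with
  | zero => simp
  | succ n ih =>
    rw [colOffset_add_one, ih, colShift_third (n : ℤ)]
    push_cast
    ring
  | pred n ih =>
    have h := colOffset_add_one third (-(n : ℤ) - 1)
    rw [sub_add_cancel, ih, colShift_third (-(n : ℤ) - 1)] at h
    rw [eq_sub_of_add_eq h.symm]
    push_cast
    ring

/-- The lower-left corner of the rhombus `(k, j)` of `H(π/3)`: `j i − i/2 + k s`. [folklore] -/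
theorem planeCorner_third (k j : ℤ) :
    planeCorner third (k, j) = (j : ℂ) * I - I / 2 + (k : ℂ) * colShift third 0 := by
  rw [planeCorner, colOffset_third]

/-- The inverse similarity: `S_δ⁻¹ w = −i w + δ/2`. [folklore] -/
theorem gmSimilarity_symm_apply (δ : ℝ) (w : ℂ) : (gmSimilarity δ).symm w = -I * w + δ / 2 := by
  rw [Homeomorph.symm_apply_eq, gmSimilarity_apply]
  ring_nf
  rw [Complex.I_sq]
  ring

/-- The real-affine map `A_δ = S_δ⁻¹ ∘ (δ ·) : z ↦ −i δ z + δ/2`. [folklore] -/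
def affA (δ : ℝ) : ℂ →ᵃ[ℝ] ℂ :=
  (LinearMap.mulLeft ℝ (-I * δ : ℂ)).toAffineMap + AffineMap.const ℝ ℂ ((δ : ℂ) / 2)

/-- Pointwise formula for `A_δ`. [folklore] -/
theorem affA_apply (δ : ℝ) (z : ℂ) : affA δ z = -I * δ * z + δ / 2 := rfl

/-- `S_δ⁻¹ (δ z) = A_δ z`. [folklore] -/
theorem symm_mul_eq_affA (δ : ℝ) (z : ℂ) : (gmSimilarity δ).symm ((δ : ℂ) * z) = affA δ z := by
  rw [gmSimilarity_symm_apply, affA_apply]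
  ring

/-- The four vertices of the unit square of `g = (k, j)`. [folklore] -/
def sqVerts (g : Face) : Set (ℝ × ℝ) :=
  {((g.2 : ℝ), (g.1 : ℝ)), ((g.2 : ℝ) + 1, (g.1 : ℝ)), ((g.2 : ℝ), (g.1 : ℝ) + 1), ((g.2 : ℝ) + 1, (g.1 : ℝ) + 1)}

/-- **The corners of the rhombus `(k, j)`, after `A_δ`, are the `ψ_δ`-images of the vertices of the
square `[j, j+1] × [k, k+1]`.** [folklore] -/
theorem affA_image_cornerSet (δ : ℝ) (g : Face) : affA δ '' cornerSet third g = psi δ '' sqVerts g := by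
  obtain ⟨k, j⟩ := g
  have hc : planeCorner third (k, j) = (j : ℂ) * I - I / 2 + (k : ℂ) * colShift third 0 := planeCorner_third k j
  have key : ∀ a b : ℝ, affA δ ((j : ℂ) * I - I / 2 + (k : ℂ) * colShift third 0 + a * I + b * colShift third 0) =
      psi δ ((j : ℝ) + a, (k : ℝ) + b) := by
    intro a b
    rw [affA_apply, psi_apply, ← I_mul_colShift_third]
    push_cast
    ring_nf
    rw [Complex.I_sq]
    ring
  simp only [cornerSet, sqVerts, image_insert_eq, image_singleton, colShift_third k, hc]
  have e1 := key 0 0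
  have e2 := key 1 0
  have e3 := key 0 1
  have e4 := key 1 1
  simp only [Complex.ofReal_zero, zero_mul, add_zero, Complex.ofReal_one, one_mul] at e1 e2 e3 e4
  rw [e1, e2, e3, e4]

/-- The unit square is the convex hull of its vertices. [folklore] -/
theorem sq_eq_convexHull (g : Face) : sq g = convexHull ℝ (sqVerts g) := by
  have hv : sqVerts g = ({(g.2 : ℝ), (g.2 : ℝ) + 1} : Set ℝ) ×ˢ ({(g.1 : ℝ), (g.1 : ℝ) + 1} : Set ℝ) := by
    ext ⟨x, y⟩
    simp only [sqVerts, mem_insert_iff, mem_singleton_iff, Prod.mk.injEq, mem_prod]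
    tauto
  rw [hv, convexHull_prod, convexHull_pair, convexHull_pair, segment_eq_Icc (by linarith),
    segment_eq_Icc (by linarith)]
  rfl

/-- **A rescaled rhombus of `H(π/3)`, pulled back by `S_δ`, is the `ψ_δ`-image of a unit square.**
[folklore] -/
theorem symm_image_rhombus (δ : ℝ) (g : Face) :
    (gmSimilarity δ).symm '' ((fun z : ℂ => (δ : ℂ) * z) '' rhombus third g) = psi δ '' sq g := by
  rw [image_image, image_congr fun z _ => symm_mul_eq_affA δ z, rhombus, AffineMap.image_convexHull,
    affA_image_cornerSet, sq_eq_convexHull, LinearMap.image_convexHull]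

/-- The union of the unit squares of a set of faces. [folklore] -/
theorem symm_image_faceUnion (Ω : Set ℂ) (δ : ℝ) (a : MidEdge) :
    (gmSimilarity δ).symm '' faceUnion (meshFaces third Ω δ) a δ =
      psi δ '' ⋃ g ∈ faceComp (meshFaces third Ω δ) a, sq g := by
  rw [faceUnion, image_iUnion₂, image_iUnion₂]
  exact iUnion₂_congr fun g _ => symm_image_rhombus δ g

/-- **The face domain in square coordinates**: `faceDomain Ω δ a = ψ_δ (interior ⋃_{g ∈ component} sq g)`.
[folklore] -/
theorem faceDomain_eq (Ω : Set ℂ) {δ : ℝ} (hδ : δ ≠ 0) (a : MidEdge) :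
    faceDomain Ω δ a = psiHomeo δ hδ '' interior (⋃ g ∈ faceComp (meshFaces third Ω δ) a, sq g) := by
  rw [faceDomain, Homeomorph.image_interior, symm_image_faceUnion, Homeomorph.image_interior, image_psiHomeo]

/-- The closure of the face domain in square coordinates. [folklore] -/
theorem closure_faceDomain_eq (Ω : Set ℂ) {δ : ℝ} (hδ : δ ≠ 0) (a : MidEdge) :
    closure (faceDomain Ω δ a) =
      psiHomeo δ hδ '' closure (interior (⋃ g ∈ faceComp (meshFaces third Ω δ) a, sq g)) := by
  rw [faceDomain_eq Ω hδ, Homeomorph.image_closure]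

/-! ### Honeycomb vertices in square coordinates -/

/-- The rhombus of `H(π/3)` carrying the triangle `v`: `v = triWN (gmFace v)` or `triSE (gmFace v)`.
[folklore] -/
def gmFace (v : HexVertex) : Face := (-(v.1 1) - 1, v.1 0)

/-- `gmFace` inverts `triWN`. [folklore] -/
@[simp] theorem gmFace_triWN (f : Face) : gmFace (triWN f) = f := by
  obtain ⟨k, j⟩ := f; simp [gmFace, triWN]

/-- `gmFace` inverts `triSE`. [folklore] -/
@[simp] theorem gmFace_triSE (f : Face) : gmFace (triSE f) = f := by
  obtain ⟨k, j⟩ := f; simp [gmFace, triSE]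

/-- Every honeycomb vertex is one of the two triangles of its rhombus. [folklore] -/
theorem eq_triWN_or_triSE (v : HexVertex) : v = triWN (gmFace v) ∨ v = triSE (gmFace v) := by
  obtain ⟨x, i⟩ := v
  fin_cases i
  · right
    simp only [triSE, gmFace, Prod.mk.injEq]
    exact ⟨(site_two_eq_iff _ _).2 ⟨by simp, by simp⟩, rfl⟩
  · left
    simp only [triWN, gmFace, Prod.mk.injEq]
    exact ⟨(site_two_eq_iff _ _).2 ⟨by simp, by simp⟩, rfl⟩

/-- The offset `t = (type + 1)/3 ∈ {1/3, 2/3}` of the centre of the triangle `v` inside its unit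
square. [folklore] -/
def tOff (v : HexVertex) : ℝ := ((v.2 : ℕ) + 1) / 3

/-- `t ∈ {1/3, 2/3}`, in particular `0 < t < 1`. [folklore] -/
theorem tOff_mem (v : HexVertex) : 0 < tOff v ∧ tOff v < 1 := by
  obtain ⟨x, i⟩ := v
  fin_cases i <;> norm_num [tOff]

/-- The square coordinates of the honeycomb vertex `v = (x, i)`: `(x₀ + t, −x₁ − t)`. [folklore] -/
def sqPt (v : HexVertex) : ℝ × ℝ := ((v.1 0 : ℝ) + tOff v, -(v.1 1 : ℝ) - tOff v)

/-- **`hexCenter v = ψ_1 (sqPt v)`**: the honeycomb of `HexSAW.lean` in square coordinates. [folklore] -/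
theorem hexCenter_eq_psi (v : HexVertex) : hexCenter v = psi 1 (sqPt v) := by
  obtain ⟨x, i⟩ := v
  rw [hexCenter, psi_apply, triEmbed]
  simp only [sqPt, tOff]
  push_cast
  ring

/-- `δ · hexCenter v = ψ_δ (sqPt v)`. [folklore] -/
theorem mul_hexCenter_eq_psi (δ : ℝ) (v : HexVertex) : (δ : ℂ) * hexCenter v = psi δ (sqPt v) := by
  rw [hexCenter_eq_psi, ← psi_eq_mul_psi_one]

/-- **The centre of a triangle lies in the open unit square of its rhombus.** [folklore] -/
theorem sqPt_mem_openSq (v : HexVertex) : sqPt v ∈ openSq (gmFace v) := by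
  obtain ⟨h1, h2⟩ := tOff_mem v
  simp only [sqPt, openSq, gmFace, mem_prod, mem_Ioo]
  push_cast
  refine ⟨⟨by linarith, by linarith⟩, by linarith, by linarith⟩

/-- **A honeycomb vertex is a vertex of the face domain iff its rhombus lies in the face component**
(`δ > 0`). [folklore] -/
theorem mul_hexCenter_mem_faceDomain_iff (Ω : Set ℂ) {δ : ℝ} (hδ : δ ≠ 0) (a : MidEdge) (v : HexVertex) :
    (δ : ℂ) * hexCenter v ∈ faceDomain Ω δ a ↔ gmFace v ∈ faceComp (meshFaces third Ω δ) a := by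
  rw [faceDomain_eq Ω hδ, image_psiHomeo, mul_hexCenter_eq_psi, (psi_injective hδ).mem_set_image]
  constructor
  · intro h
    exact mem_of_mem_openSq_of_mem_closure (sqPt_mem_openSq v) (subset_closure (interior_subset h))
  · intro h
    exact openSq_subset_interior h (sqPt_mem_openSq v)

/-- A honeycomb vertex whose rescaled centre lies in the closure of the face domain has its rhombus
in the face component. [folklore] -/
theorem gmFace_mem_of_mem_closure (Ω : Set ℂ) {δ : ℝ} (hδ : δ ≠ 0) (a : MidEdge) {v : HexVertex}
    (h : (δ : ℂ) * hexCenter v ∈ closure (faceDomain Ω δ a)) : gmFace v ∈ faceComp (meshFaces third Ω δ) a := by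
  rw [closure_faceDomain_eq Ω hδ, image_psiHomeo, mul_hexCenter_eq_psi, (psi_injective hδ).mem_set_image] at h
  exact mem_of_mem_openSq_of_mem_closure (sqPt_mem_openSq v) (closure_mono interior_subset h)

/-- **Main statement of this file (registered sub-goal of `stub_gmHexDictionary`)**: a honeycomb vertex is
a vertex of the face domain iff its rhombus lies in the face component. [folklore] -/
theorem mul_hexCenter_mem_faceDomain_iff_gmFace : ∀ (Ω : Set ℂ) (δ : ℝ), δ ≠ 0 → ∀ (a : MidEdge) (v : HexVertex), (δ : ℂ) * hexCenter v ∈ faceDomain Ω δ a ↔ gmFace v ∈ faceComp (meshFaces third Ω δ) a := by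
  intro Ω δ hδ a v
  exact mul_hexCenter_mem_faceDomain_iff Ω hδ a v

end Summit.CriticalPhenomena.SAWScalingLimit.Cruxes.HexTransfer.YbRelay

end
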